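import Literature.Computability.Cryptography.RegevReductionCVPqStability
import HarnessLib

/-!
# Regev 2009, §3.2.1 (Lemmas 3.6/3.7/3.11/4.1) as a program: the residual A_cvpqM split into an
# integer-Gaussian coin sampler (A_gsamp) and pure plumbing (A_plumb), with the assembly proved

Topic `Computability/Cryptography` (family `pqc`), sequel of `RegevReductionCVPqSplit.lean` (residual
A_cvpqM = `regev2009_lemma_3_11_cvpqMachine q α`: a uniform quantum family simulates, up to a negligible
additive error, the batch-conditional experiment `Regev2009.DigitOracle.condExp`) and of
`RegevReductionCVPqStability.lean` (that experiment is STABLE under perturbation of its three primitive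
laws: `simulates_condExp_of_condExpS`, `tvDist_shiftLawBits_size_add_le`). O. Regev, *On lattices,
learning with errors, random linear codes, and cryptography*, J. ACM 56 (2009), art. 34 (author's version
arXiv:2401.03703): Lemma 3.11 (p. 18, proof, Eq. (10)), Lemma 3.7 (p. 16, proof), Lemma 3.6 (p. 16),
Lemma 4.1 (p. 23).

A_cvpqM mixes two things of a different nature: (i) NUMERICS — a polynomial-time string function that
turns fair coins into an integer `⌊M·e⌋`, `e ← N(0, s/2π)`, within statistical distance `2^{-ℓ}` (the
noise "`e`" of Eq. (10) and of Lemma 3.7's padding, which the reduction draws itself; an integer Gaussian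
has irrational point masses, so a coin machine is only `2^{-ℓ}`-exact); (ii) PLUMBING — a uniform quantum
family that runs the classical procedure of §3.2.1 with the `LWE` machine `W` as a subroutine and with
ANY given string function in the role of the noise sampler, realising EXACTLY (up to a negligible `ν`)
the experiment `condExpS` run with the sampler's ACTUAL output laws and with the coin shift sampler
`shiftLawBits` (blocks of `size q + n` coins read `mod q`). This file records (i) and (ii) as two named
facts and PROVES `A_gsamp → A_plumb → A_cvpqM` from the stability theorem: the statistical bookkeeping
(`(K_g+1)(n+1)·(n/2ⁿ + (m + N_V)·2⁻ⁿ)`, negligible, dominated by `Peikert2009.failureBound`) is done here,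
once and for all, so that neither residual contains any probability estimate.

## What this file does

* `Regev2009.sampParams`, `decodeIntD`, `sampLaw`: the calling convention of the integer-Gaussian sampler
  (`⟨M, ⟨s, 1^ℓ⟩⟩` then `p_c(|params|)` coins; output decoded by `encodingIntBool`, junk `0`) and its
  output law; `padVar a K_g J j = a²/2 + lvl_j·a²/K_g ∈ ℚ`, the rational variance parameters of Lemma 3.7's
  padded noise (`padNoise (a) … j ^ 2 = padVar a … j`, `sq_padNoise_eq_padVar`).
* NAMED FACT `floorGaussianSamplerFP` (**residual A_gsamp**): a polynomial-time string function whose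
  output law on `⟨M, ⟨s, 1^ℓ⟩⟩` and uniform coins is within `2^{-ℓ}` of `floorGaussian M σ` whenever
  `σ² = s` (inversion sampling with the normal distribution function evaluated to polynomial precision).
* NAMED FACT `regev2009_lemma_3_11_cvpqPlumbing q α` (**residual A_plumb**): for every string function
  `samp ∈ FP` with coin polynomial `p_c` and every uniform quantum family `W` there are a uniform quantum
  family `T` and a negligible `ν` such that, eventually, on every query of `RegevReductionCVPqSplit.lean`,
  `T` fails to print the table of a candidate `c` with probability at most that of `condExpS` — run with
  the shift law `shiftLawBits n q (size q + n)`, the coarse laws `sampLaw samp p_c (q N₀(t)) (padVar (a n) …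
  j) n` and the fine law `sampLaw samp p_c (512 q N₀(t)) ((a n)²/2) n` — not returning `c`, plus `ν(n)`.
  NO property of `samp` is assumed: the fact is composition of programs only.
* PROVED: **`regev2009_lemma_3_11_cvpqMachine_of_sampler_of_plumbing :
  floorGaussianSamplerFP → regev2009_lemma_3_11_cvpqPlumbing q α → regev2009_lemma_3_11_cvpqMachine q α`**
  (precision `ℓ = n`, shift blocks of `size q + n` coins; error `failureBound m N_V (2⁻ⁿ) (n/2ⁿ) + |ν|`,
  negligible by `Peikert2009.isNegligible_failureBound`), and the corollaries down to `pqc.S19`: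
  `regev_lwe_to_sivp_quantum_holds_of_sampler_of_plumbing_of_step`,
  `regev_lwe_to_gapSVP_quantum_holds_of_sampler_of_plumbing_of_step`.

Neither fact restates A_cvpqM, A_cvpq or a target: A_gsamp mentions no lattice, no oracle and no quantum
machine; A_plumb assumes nothing about the sampler and contains no statistical claim about Gaussians or
uniform shifts. Trust base of `pqc.S19` after this file: {A_gsamp, A_plumb, A_q14} in place of
{A_cvpqM, A_q14} (A_cvpqM is now a theorem of A_gsamp and A_plumb).

HONEST FRAMING: the value is a THEOREM about a KNOWN reduction (the statistical bookkeeping separating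
Regev's §3.2.1 program into numerics and plumbing, kernel-checked, standard axioms) and two precisely
typed residual facts — it is NOT progress on any summit, breaks nothing, and discharges neither residual.

References: RegevLWE2009 / Regev2009 (arXiv:2401.03703: Lemma 3.6 p. 16, Lemma 3.7 p. 16, Lemma 3.11
p. 18 (Eq. (10)), Lemma 4.1 p. 23); KnuthTAOCP2 (§3.4.1: the inversion method, normal deviates);
BrentZimmermann2010 (§4.4: power series to prescribed precision with the remainder bound (4.21));
BennettBernsteinBrassardVazirani1997 (Thm. 4.14: composition of uniform quantum families with
subroutines); Goldreich2001 (§3.2: statistical distance).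
-/

noncomputable section

open Finset Module MeasureTheory Filter
open scoped ENNReal

namespace Literature.Computability.Cryptography

namespace Regev2009

open _root_.Computability Literature.Computability.Complexity Literature.Computability.QuantumComplexity
  Literature.Algebra.EuclideanLattices

/-! ### The integer-Gaussian sampler: calling convention, output law, rational variances -/

/-- LOCAL GLUE. **Parameter string of one sampler call**: `⟨M, ⟨s, 1^ℓ⟩⟩` — the scale `M` in binary, the
variance parameter `s ∈ ℚ` as a reduced fraction, the precision `ℓ` in UNARY (so that polynomial time in
the input length affords `ℓ` bits of accuracy). [cite: AroraBarak2009, §0.1 (codes of tuples)] -/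
def sampParams (M : ℕ) (s : ℚ) (ℓ : ℕ) : List Bool :=
  boolPair (encodeNat M) (boolPair (encodeRat s) (unaryEncodeNat ℓ))

/-- LOCAL GLUE. **Total integer decoder** (`encodingIntBool`; junk value `0` on malformed words).
[cite: AroraBarak2009, §0.1] -/
def decodeIntD (w : List Bool) : ℤ := (encodingIntBool.decode w).getD 0

/-- `decodeIntD` inverts the integer code. [folklore] -/
@[simp] theorem decodeIntD_encode (z : ℤ) : decodeIntD (encodingIntBool.encode z) = z := by
  simp [decodeIntD, encodingIntBool.decode_encode]

/-- LOCAL GLUE. **The output law of a sampler program** `samp` on parameters `(M, s, ℓ)`: run on the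
parameter string paired with `p_c(|params|)` uniform coins, output decoded as an integer.
[cite: KnuthTAOCP2, §3.4.1 (random deviates from uniform bits)] -/
def sampLaw (samp : List Bool → List Bool) (pc : Polynomial ℕ) (M : ℕ) (s : ℚ) (ℓ : ℕ) : PMF ℤ :=
  (PMF.uniformOfFintype (QReg (pc.eval (sampParams M s ℓ).length))).map
    fun c => decodeIntD (samp (boolPair (sampParams M s ℓ) (List.ofFn c)))

/-- LOCAL GLUE. **Rational variance parameters of the padded coarse noise** of block `j` (level
`lvl_j = (finProdFinEquiv.symm j).1`): `a²/2 + lvl_j · a²/K_g`, the square of `padNoise a K_g J j`.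
[cite: RegevLWE2009, Lemma 3.7 (proof: "the set Z of all integer multiples of n^{-2c}α² between 0 and α²")] -/
def padVar (a : ℚ) (Kg J : ℕ) (j : Fin ((Kg + 1) * J)) : ℚ :=
  a ^ 2 / 2 + ((finProdFinEquiv.symm j).1 : ℕ) * (a ^ 2 / Kg)

/-- `padVar ≥ 0`. [folklore] -/
theorem padVar_nonneg (a : ℚ) (Kg J : ℕ) (j : Fin ((Kg + 1) * J)) : 0 ≤ padVar a Kg J j := by
  unfold padVar; positivity

/-- `padNoise a … j ^ 2 = padVar a … j` (cast to `ℝ`). [folklore] -/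
theorem sq_padNoise_eq_padVar (a : ℚ) (Kg J : ℕ) (j : Fin ((Kg + 1) * J)) :
    padNoise (a : ℝ) Kg J j ^ 2 = ((padVar a Kg J j : ℚ) : ℝ) := by
  unfold padNoise padVar
  rw [Real.sq_sqrt (by positivity), div_pow, Real.sq_sqrt (by norm_num : (0:ℝ) ≤ 2)]
  push_cast
  ring

/-- `(a/√2)² = a²/2` (cast form). [folklore] -/
theorem sq_div_sqrt_two_eq (a : ℚ) : ((a : ℝ) / Real.sqrt 2) ^ 2 = (((a ^ 2 / 2 : ℚ)) : ℝ) := by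
  rw [div_pow, Real.sq_sqrt (by norm_num : (0:ℝ) ≤ 2)]
  push_cast
  ring

end Regev2009

/-! ### The two residual facts and the proved assembly -/

section Split

open _root_.Computability Literature.Computability.Complexity Literature.Computability.Complexity.CodeFP
  Literature.Computability.QuantumComplexity Literature.Algebra.EuclideanLattices Regev2009
  Regev2009.DigitOracle Peikert2009 LWE Literature.Probability.Distributions Literature.Probability.Moments

variable (q : ℕ → ℕ) [∀ n, NeZero (q n)] (α : ℕ → ℝ)

/-- NAMED FACT (residual A_gsamp) — **a polynomial-time coin sampler for rounded Gaussians.** There is a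
polynomial-time string function `samp` with a coin polynomial `p_c` such that for all `M ∈ ℕ`, `s ∈ ℚ`,
`ℓ ∈ ℕ` and every real `σ` with `σ² = s`, the law of its decoded output on the parameter string
`⟨M, ⟨s, 1^ℓ⟩⟩` and `p_c(|⟨M, ⟨s, 1^ℓ⟩⟩|)` uniform coins is within statistical distance `2^{-ℓ}` of
`floorGaussian M σ` = the law of `⌊M·e⌋`, `e ← N(0, σ²/2π)` (Regev's "`e`" in Eq. (10) of Lemma 3.11
and the padding noise of Lemma 3.7, in the integer arithmetic of `RegevReductionCVPqSplit.lean`).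
Mechanism (not formalised): inversion sampling — read the coins as a dyadic `u ∈ [0,1)`, binary-search
the integer `k` with `Φ(k/(Mσ')) ≤ u < Φ((k+1)/(Mσ'))`, `σ' = σ/√(2π)`, evaluating the normal
distribution function by its power series to `ℓ + O(log(M σ' ℓ))` bits; tails beyond `Mσ'√(2ℓ)` and the
grid of `u` cost `≤ 2^{-ℓ}` in total. Its content is numerics only (no lattice, no oracle, no quantum
machine). Tree assets for a proof, and why they do not already give it: the PROVED coin rejection sampler
`GaussRej.rejLaw` of `Probability/Distributions/GaussianRejectionSampler.lean` serves `D_{ℤ,√(π/θ),c}` for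
RATIONAL `θ`, whereas here `σ² = s ∈ ℚ` makes `θ = π/(Mσ)² ∈ π·ℚ`; and the PROVED comparison
`Regev2009.tvDist_discreteGaussianInt_floorGaussian_le` (`FloorGaussianSampling.lean`,
`Δ(D_{ℤ,Mσ}, floorGaussian M σ) ≤ 2/(Mσ)`) is not negligible at the scales `M = q·N₀(t)` that occur
(`N₀(t) = 2` for integral `t`) — a proof along that path needs `π` to polynomial precision inside
`expNegApprox` and an auxiliary fine grid `⌊D_{ℤ,MM'σ}/M'⌋`. Users take `(hS : floorGaussianSamplerFP)`.
[cite: KnuthTAOCP2, §3.4.1 (inversion method; normal deviates); BrentZimmermann2010, §4.4 (power series with remainder bound (4.21)); RegevLWE2009, Lemma 3.11 (p. 18, Eq. (10): "e"), Lemma 3.7 (p. 16)] -/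
def floorGaussianSamplerFP : Prop :=
  ∃ (samp : List Bool → List Bool) (pc : Polynomial ℕ), samp ∈ FP ∧
    ∀ (M : ℕ) (s : ℚ) (ℓ : ℕ) (σ : ℝ), σ ^ 2 = s →
      (sampLaw samp pc M s ℓ).tvDist (floorGaussian M σ) ≤ (2⁻¹ : ℝ) ^ ℓ

/-- NAMED FACT (residual A_plumb) — **Regev 2009, §3.2.1 as a composition of programs.** Lemma 3.11
(p. 18, proof): "Since we can efficiently sample from [the distribution (10)] using the given samples from
`D_{L,r}`, we can apply `W` in order to find `s`"; Lemma 3.7 (p. 16, proof): "estimate the behavior of `W`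
… by adding … a small amount of noise … using Lemma 3.6 … repeat"; Lemma 4.1 (p. 23): the shift
`(a, b) ↦ (a, b + ⟨a, t⟩)`. Machine form WITHOUT numerics: for every polynomially bounded `m`, poly-time
parameters with `α = a ∈ ℚ` computable, every string function `samp ∈ FP` with a coin polynomial `p_c`
(NO property of `samp` is assumed) and every uniform quantum family `W`, there are a uniform quantum family
`T` and a negligible `ν` such that, eventually in `n`, for every nonsingular instance `I` of dimension `n`,
all `ρ, k`, every rational `t`, every batch `w` of `≥ nVectors (m n) n` lattice vectors and every candidate
`c ∈ ℤ_qⁿ`: the probability that `T` on `DigitOracle.query I ρ k (encBatch …) t` does not print the table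
of `c` is at most the probability that `DigitOracle.condExpS` — the conditional experiment of
`RegevReductionCVPqSplit.lean` run with the shift law `shiftLawBits n q (size q + n)` (`n` blocks of
`size q + n` fair coins read `mod q`), the coarse noise laws `sampLaw samp p_c (q·N₀(t)) (padVar (a n) K_g J j) n`
and the fine noise law `sampLaw samp p_c (512·q·N₀(t)) ((a n)²/2) n`, the calls to `W.searchLWESolver`, the
explicit integer arithmetic and the rational cosine test — does not return `c`, plus `ν(n)`. Content:
fixed-point-free integer/rational arithmetic on codes, coin bookkeeping, and the composition of uniform
families with the subroutines `samp` and `W` (BBBV, Thm. 4.14); every law it mentions is the EXACT law of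
the program it describes. Users take `(hT : regev2009_lemma_3_11_cvpqPlumbing q α)`.
[cite: Regev2009, Lemma 3.11 (p. 18), Lemma 3.7 (p. 16), Lemma 3.6 (p. 16), Lemma 4.1 (p. 23); BennettBernsteinBrassardVazirani1997, Thm. 4.14] -/
def regev2009_lemma_3_11_cvpqPlumbing : Prop :=
  ∀ (m : ℕ → ℕ) (_ : IsPolyBounded m) (_ : IsPolyTimeParams q α m)
    (a : ℕ → ℚ), (∀ n, α n = a n) → PolyTimeComputable unaryEncodeNat encodeRat a →
    ∀ (samp : List Bool → List Bool) (pc : Polynomial ℕ), samp ∈ FP →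
    ∀ W : UniformQCircuitFamily,
      ∃ (T : UniformQCircuitFamily) (ν : ℕ → ℝ), IsNegligible ν ∧
        ∀ᶠ n : ℕ in atTop, ∀ (I : LatticeInstance) (hI : I.IsNonsingular) (ρ : ℚ) (k : ℕ) (t : Fin I.n → ℚ)
          (P : ℕ) (w : Fin P → I.lattice) (hP : nVectors (m I.n) I.n ≤ P) (c : Fin I.n → ZMod (q I.n)),
          I.n = n →
          (T.kernel (query I ρ k (encBatch I.n P fun i => I.intCoords (w i)) t)).toOuterMeasure
              {σ | CVPOracle.table (Nat.size (q I.n)) (fun j => (c j).val) <+: σ}ᶜ ≤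
            (condExpS (q I.n) (m I.n) (α I.n) I hI (W.searchLWESolver I.n (q I.n) (m I.n)) t w hP
                (shiftLawBits I.n (q I.n) (Nat.size (q I.n) + I.n))
                (fun j => sampLaw samp pc (q I.n * denom t) (padVar (a I.n) (nLevels (m I.n)) (schedJ I.n) j) I.n)
                (sampLaw samp pc (q I.n * schedK * denom t) ((a I.n) ^ 2 / 2) I.n)).toOuterMeasure
                {o | o ≠ some c} + ENNReal.ofReal (ν n)

/-- The statistical bookkeeping: the sampler errors of one run are dominated by `failureBound`.
[folklore] -/
theorem samplerError_le_failureBound (m : ℕ → ℕ) (n : ℕ) :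
    (((nLevels (m n) + 1) * schedJ n : ℕ) : ℝ) *
        ((n : ℝ) / 2 ^ n + (m n : ℝ) * (2⁻¹ : ℝ) ^ n + (nVerify n : ℝ) * (2⁻¹ : ℝ) ^ n) ≤
      failureBound m nVerify (fun n => (2⁻¹ : ℝ) ^ n) (fun n => (n : ℝ) / 2 ^ n) n := by
  rw [failureBound]
  have hKg : nLevels (m n) = schedKg m n := rfl
  rw [hKg]
  have hB : (0 : ℝ) ≤ ((schedKg m n + 1) * schedJ n : ℕ) := Nat.cast_nonneg _
  have h2 : (0 : ℝ) ≤ (2⁻¹ : ℝ) ^ n := pow_nonneg (by norm_num) _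
  have hmN : (0 : ℝ) ≤ (m n : ℝ) + (nVerify n : ℝ) := by positivity
  have hJ : (0 : ℝ) ≤ (1 / 2 : ℝ) ^ schedJ n := pow_nonneg (by norm_num) _
  nlinarith [mul_nonneg hB (mul_nonneg hmN h2)]

/-- **THE ASSEMBLY (proved): A_gsamp → A_plumb → A_cvpqM.** With precision `ℓ = n` for every sampler call
and shift blocks of `size q + n` coins, the machine of A_plumb simulates `DigitOracle.condExp` up to
`failureBound m N_V (2⁻ⁿ) (n/2ⁿ)(n) + |ν(n)|` (negligible): `simulates_condExp_of_condExpS` with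
`δ_U = n/2ⁿ` (`tvDist_shiftLawBits_size_add_le`), `δ_c = δ_f = 2⁻ⁿ` (A_gsamp at `σ = padNoise (a n) … j`,
`σ² = padVar`, and at `σ = α/√2`, `σ² = a²/2`). [cite: Regev2009, Lemma 3.11 (p. 18), Lemma 3.7 (p. 16), Lemma 4.1 (p. 23)] -/
theorem regev2009_lemma_3_11_cvpqMachine_of_sampler_of_plumbing (hS : floorGaussianSamplerFP)
    (hT : regev2009_lemma_3_11_cvpqPlumbing q α) : regev2009_lemma_3_11_cvpqMachine q α := by
  intro m hm hpar a haα hac W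
  obtain ⟨samp, pc, hfp, hlaw⟩ := hS
  obtain ⟨T, ν, hν, hTn⟩ := hT m hm hpar a haα hac samp pc hfp W
  have hNVpb : IsPolyBounded nVerify := ⟨1600000 * (Polynomial.X + 1), fun n => by
    simp [nVerify, schedNV]; omega⟩
  have hfb : IsNegligible (failureBound m nVerify (fun n => (2⁻¹ : ℝ) ^ n) fun n => (n : ℝ) / 2 ^ n) :=
    isNegligible_failureBound hm hNVpb isNegligible_two_inv_pow (fun n => by positivity)
      isNegligible_nat_div_two_pow (fun n => by positivity)
  have hνa : IsNegligible fun n => |ν n| :=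
    Asymptotics.SuperpolynomialDecay.trans_abs_le hν fun n => by rw [abs_abs]
  refine ⟨T, fun n => failureBound m nVerify (fun n => (2⁻¹ : ℝ) ^ n) (fun n => (n : ℝ) / 2 ^ n) n + |ν n|,
    hfb.add hνa, ?_⟩
  filter_upwards [hTn] with n hT I hI ρ k t P w hP c hIn
  have hx := hT I hI ρ k t P w hP c hIn
  subst hIn
  -- the three sampler errors
  have hU : (shiftLawBits I.n (q I.n) (Nat.size (q I.n) + I.n)).tvDist
      (PMF.uniformOfFintype (Fin I.n → ZMod (q I.n))) ≤ (I.n : ℝ) / 2 ^ I.n :=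
    tvDist_shiftLawBits_size_add_le I.n (q I.n) I.n
  have hc : ∀ j, (sampLaw samp pc (q I.n * denom t) (padVar (a I.n) (nLevels (m I.n)) (schedJ I.n) j) I.n).tvDist
      (floorGaussian (q I.n * denom t) (padNoise (α I.n) (nLevels (m I.n)) (schedJ I.n) j)) ≤ (2⁻¹ : ℝ) ^ I.n :=
    fun j => hlaw _ _ _ _ (by rw [haα]; exact sq_padNoise_eq_padVar (a I.n) _ _ j)
  have hf : (sampLaw samp pc (q I.n * schedK * denom t) ((a I.n) ^ 2 / 2) I.n).tvDist
      (floorGaussian (q I.n * schedK * denom t) (α I.n / Real.sqrt 2)) ≤ (2⁻¹ : ℝ) ^ I.n :=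
    hlaw _ _ _ _ (by rw [haα]; exact sq_div_sqrt_two_eq (a I.n))
  -- stability
  have h := simulates_condExp_of_condExpS (q I.n) (m I.n) (α I.n) I hI (W.searchLWESolver I.n (q I.n) (m I.n))
    t w hP _ _ _ hU hc hf {o | o ≠ some c} hx
  refine h.trans ?_
  have hB0 : (0 : ℝ) ≤ (((nLevels (m I.n) + 1) * schedJ I.n : ℕ) : ℝ) *
      ((I.n : ℝ) / 2 ^ I.n + (m I.n : ℝ) * (2⁻¹ : ℝ) ^ I.n + (nVerify I.n : ℝ) * (2⁻¹ : ℝ) ^ I.n) := by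
    positivity
  have hfb0 : (0 : ℝ) ≤ failureBound m nVerify (fun n => (2⁻¹ : ℝ) ^ n) (fun n => (n : ℝ) / 2 ^ n) I.n :=
    hB0.trans (samplerError_le_failureBound m I.n)
  rw [add_assoc, ENNReal.ofReal_add hfb0 (abs_nonneg _)]
  gcongr
  · exact samplerError_le_failureBound m I.n
  · exact le_abs_self _

/-- **pqc.S19 (both clauses) from A_gsamp, A_plumb and residual A_q14.** [cite: Regev2009, Theorem 3.1, Lemma 3.4 (Lemmas 3.6, 3.7, 3.11, 4.1), Lemma 3.14] -/
theorem regev_lwe_to_sivp_quantum_holds_of_sampler_of_plumbing_of_step (m : ℕ → ℕ)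
    (hS : floorGaussianSamplerFP) (hT : regev2009_lemma_3_11_cvpqPlumbing q α)
    (hQ : regev2009_lemma_3_14_stepFamily q α) : regev_lwe_to_sivp_quantum q α m :=
  regev_lwe_to_sivp_quantum_holds_of_machine_of_step q α m
    (regev2009_lemma_3_11_cvpqMachine_of_sampler_of_plumbing q α hS hT) hQ

/-- The `GapSVP` clause of pqc.S19 from A_gsamp, A_plumb and A_q14. [cite: Regev2009, Theorem 3.1; MicciancioRegev2009DGS, Lemma 3.19] -/
theorem regev_lwe_to_gapSVP_quantum_holds_of_sampler_of_plumbing_of_step (m : ℕ → ℕ)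
    (hS : floorGaussianSamplerFP) (hT : regev2009_lemma_3_11_cvpqPlumbing q α)
    (hQ : regev2009_lemma_3_14_stepFamily q α) : regev_lwe_to_gapSVP_quantum q α m :=
  regev_lwe_to_gapSVP_quantum_holds_of_machine_of_step q α m
    (regev2009_lemma_3_11_cvpqMachine_of_sampler_of_plumbing q α hS hT) hQ

end Split

end Literature.Computability.Cryptography
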